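import Mathlib.Analysis.SpecialFunctions.Complex.CircleAddChar
import Mathlib.Algebra.Group.AddChar
import Mathlib.Algebra.Group.Subgroup.Finite
import Mathlib.Data.ZMod.Basic
import HarnessLib

/-!
# `#K · #K^⊥ = #G` for a perfect pairing of two finite abelian groups (basis-free)

Layer `Literature/GroupTheory/Abelian`, namespace `Literature.GroupTheory.Abelian.PerfectPairing`.  THEOREMS ONLY (no
definition, no named fact, no instance).  Cell hodgecm-mathlib (D-0151), Hecke-link socket (B), the `hcount` input of the
`htype` adapter of the quotient-triple package (B-plan1 (g15) 2026-08-30T00:21:07Z (b)): with `K′ := K^⊥` the annihilator of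
`K ≤ A′[d]` in `Â′[d]` under the `e_d`-pairing, the product law **`#K · #K^⊥ = #A′[d]`** holds for EVERY subgroup `K`
by perfectness alone — no Smith normal form, no `#K = d^g`, no choice of symplectic basis.  This file is the basis-free
companion of ★ `Literature.GroupTheory.Abelian.ZModPairing.natCard_annihilator_mul_natCard` (the same count for the
matrix pairing `ᵗh J c` on `(ℤ/n)^ι`), proved by the same double counting.

Setting: `G`, `H` finite abelian groups and a bi-additive pairing `e : G →+ H →+ ℤ/n` (B-plan1 (g15) 00:27:14Z (2):
the additive `ℤ/n`-valued currency only).  For `K ≤ G` write `K^⊥ = {h ∈ H : e k h = 0 ∀ k ∈ K}` (spelled as a subtype,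
no definition is introduced).

* `natCard_mul_natCard_annihilator_of_forall` — if `e` is non-degenerate ON `K` (`k ∈ K`, `e k = 0 ⇒ k = 0`) then
  `#K · #K^⊥ = #H`;
* `natCard_eq_of_nondegenerate` — if `e` is non-degenerate on both sides then `#G = #H`;
* `natCard_mul_natCard_annihilator` — if `e` is non-degenerate on both sides then `#K · #K^⊥ = #G` for every `K ≤ G`,
  and `natCard_mul_natCard_annihilator_left` — the same for `L ≤ H` and its annihilator in `G`.

Proof (double counting with the standard additive character `ψ = e^{2πi·/n}` of `ℤ/n`, [MumfordAV1970] §23 p. 233 style;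
[SerreLinearRepresentations1977] §2.3 orthogonality): `S := Σ_{k ∈ K} Σ_{h ∈ H} ψ(e k h)`.  For fixed `k`, `h ↦ ψ(e k h)` is
an additive character of `H`, trivial iff `e k = 0` (faithfulness of `ψ`) iff `k = 0`, so `S = #H` (Mathlib
`AddChar.sum_eq_ite`); for fixed `h`, `k ↦ ψ(e k h)` is an additive character of `K`, trivial iff `h ∈ K^⊥`, so
`S = #K^⊥ · #K`.

## References

* [MumfordAV1970] D. Mumford, *Abelian Varieties* (1970), §23 (p. 233) (the non-degenerate pairing `e^L` on `K(L)`; orders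
  of isotropic subgroups and of their annihilators).
* [SerreLinearRepresentations1977] J.-P. Serre, *Linear Representations of Finite Groups* (1977), §2.3 (orthogonality
  of characters) — the double-counting device.
-/

noncomputable section

open Finset AddChar

namespace Literature.GroupTheory.Abelian.PerfectPairing

/-! ### Bi-additive pairings `G × H → ℤ/n` -/

section Additive

variable {G H : Type*} [AddCommGroup G] [AddCommGroup H] {n : ℕ}

/-- The standard character of `ℤ/n` is faithful: `ψ(a) = 1` forces `a = 0` (Mathlib `ZMod.injective_stdAddChar`).
[cite: SerreLinearRepresentations1977, §2.3] -/
theorem eq_zero_of_stdAddChar_eq_one [NeZero n] {a : ZMod n} (h : ZMod.stdAddChar a = 1) : a = 0 :=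
  ZMod.injective_stdAddChar (by rw [h, map_zero_eq_one])

/-- **Row criterion**: `ψ(e k h) = 1` for every `h` iff `e k h = 0` for every `h`. [cite: MumfordAV1970, §23 (p. 233)] -/
theorem forall_stdAddChar_apply_eq_one_iff [NeZero n] (e : G →+ H →+ ZMod n) (k : G) :
    (∀ h : H, ZMod.stdAddChar (e k h) = 1) ↔ ∀ h : H, e k h = 0 :=
  ⟨fun hk h => eq_zero_of_stdAddChar_eq_one (hk h), fun hk h => by rw [hk h, map_zero_eq_one]⟩

/-- **Column criterion**: for a subgroup `K`, `ψ(e k h) = 1` for every `k ∈ K` iff `h ∈ K^⊥`.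
[cite: MumfordAV1970, §23 (p. 233)] -/
theorem forall_mem_stdAddChar_apply_eq_one_iff [NeZero n] (e : G →+ H →+ ZMod n) (K : AddSubgroup G) (h : H) :
    (∀ k ∈ K, ZMod.stdAddChar (e k h) = 1) ↔ ∀ k ∈ K, e k h = 0 :=
  ⟨fun hh k hk => eq_zero_of_stdAddChar_eq_one (hh k hk), fun hh k hk => by rw [hh k hk, map_zero_eq_one]⟩

variable [Finite G] [Finite H]

/-- **`#K · #K^⊥ = #H`** for a bi-additive pairing `e : G × H → ℤ/n` that is non-degenerate ON the subgroup `K ≤ G`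
(`k ∈ K`, `e(k, ·) = 0 ⇒ k = 0`), `K^⊥ = {h : e(k, h) = 0 ∀ k ∈ K}` (double counting `Σ_{k ∈ K} Σ_h ψ(e k h)`).
[cite: MumfordAV1970, §23 (p. 233)] [cite: SerreLinearRepresentations1977, §2.3] -/
theorem natCard_mul_natCard_annihilator_of_forall [NeZero n] (e : G →+ H →+ ZMod n) (K : AddSubgroup G)
    (hK : ∀ k ∈ K, (∀ h : H, e k h = 0) → k = 0) :
    Nat.card K * Nat.card {h : H // ∀ k ∈ K, e k h = 0} = Nat.card H := by
  classical
  have _iG : Fintype G := Fintype.ofFinite G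
  have _iH : Fintype H := Fintype.ofFinite H
  -- the row characters `h ↦ ψ(e k h)` (`k ∈ K`) and the column characters `k ↦ ψ(e k h)` (`h ∈ H`)
  let row : K → AddChar H ℂ := fun k => ZMod.stdAddChar.compAddMonoidHom (e (k : G))
  let col : H → AddChar K ℂ := fun h => ZMod.stdAddChar.compAddMonoidHom ((e.flip h).comp K.subtype)
  have hrow : ∀ (k : K) (h : H), row k h = ZMod.stdAddChar (e (k : G) h) := fun _ _ => rfl
  have hcol : ∀ (h : H) (k : K), col h k = ZMod.stdAddChar (e (k : G) h) := fun _ _ => rfl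
  -- summed by rows: only `k = 0` contributes, and it contributes `#H`
  have hS₁ : (∑ k : K, ∑ h : H, row k h) = (Fintype.card H : ℂ) := by
    have hterm : ∀ k : K, (∑ h : H, row k h) = if k = 0 then (Fintype.card H : ℂ) else 0 := by
      intro k
      rw [AddChar.sum_eq_ite]
      by_cases h0 : k = 0
      · have hz : row k = 0 := by
          ext h; rw [hrow, h0, AddSubgroup.coe_zero, map_zero, AddMonoidHom.zero_apply, map_zero_eq_one,
            AddChar.zero_apply]
        rw [if_pos hz, if_pos h0]
      · have hz : row k ≠ 0 := by
          intro hz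
          apply h0
          have h' : (k : G) = 0 :=
            hK k k.2 ((forall_stdAddChar_apply_eq_one_iff e k).1 fun h => by rw [← hrow, hz, AddChar.zero_apply])
          exact Subtype.ext h'
        rw [if_neg hz, if_neg h0]
    simp_rw [hterm]
    rw [Finset.sum_ite_eq' Finset.univ (0 : K) (fun _ => (Fintype.card H : ℂ)), if_pos (Finset.mem_univ _)]
  -- summed by columns: `#K` for `h ∈ K^⊥`, else `0`
  have hS₂ : (∑ h : H, ∑ k : K, col h k) =
      ((Finset.univ.filter fun h : H => ∀ k ∈ K, e k h = 0).card : ℂ) * Fintype.card K := by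
    have hterm : ∀ h : H, (∑ k : K, col h k) = if (∀ k ∈ K, e k h = 0) then (Fintype.card K : ℂ) else 0 := by
      intro h
      rw [AddChar.sum_eq_ite]
      by_cases hc : ∀ k ∈ K, e k h = 0
      · have hz : col h = 0 := by
          ext k; rw [hcol, hc k k.2, map_zero_eq_one, AddChar.zero_apply]
        rw [if_pos hz, if_pos hc]
      · have hz : col h ≠ 0 := by
          intro hz
          apply hc
          rw [← forall_mem_stdAddChar_apply_eq_one_iff]
          intro k hk
          rw [← hcol h ⟨k, hk⟩, hz, AddChar.zero_apply]
        rw [if_neg hz, if_neg hc]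
    simp_rw [hterm]
    rw [Finset.sum_ite, Finset.sum_const_zero, add_zero, Finset.sum_const, nsmul_eq_mul]
  -- the two summations agree
  have hS : (∑ k : K, ∑ h : H, row k h) = ∑ h : H, ∑ k : K, col h k := by
    rw [Finset.sum_comm]
    exact Finset.sum_congr rfl fun h _ => Finset.sum_congr rfl fun k _ => by rw [hrow, hcol]
  rw [hS₁, hS₂] at hS
  rw [Nat.card_eq_fintype_card, Nat.card_eq_fintype_card, Nat.card_eq_fintype_card,
    Fintype.card_subtype (fun h : H => ∀ k ∈ K, e k h = 0), mul_comm]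
  exact_mod_cast hS.symm

/-- **`#G = #H`** for a bi-additive pairing `e : G × H → ℤ/n` of finite abelian groups non-degenerate on both sides.
[cite: MumfordAV1970, §23 (p. 233)] -/
theorem natCard_eq_of_nondegenerate [NeZero n] (e : G →+ H →+ ZMod n)
    (hl : ∀ g : G, (∀ h : H, e g h = 0) → g = 0) (hr : ∀ h : H, (∀ g : G, e g h = 0) → h = 0) :
    Nat.card G = Nat.card H := by
  have key := natCard_mul_natCard_annihilator_of_forall e ⊤ fun k _ hk => hl k hk
  have h1 : Nat.card {h : H // ∀ k ∈ (⊤ : AddSubgroup G), e k h = 0} = 1 := by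
    rw [Nat.card_eq_one_iff_exists]
    refine ⟨⟨0, fun k _ => by rw [map_zero]⟩, fun y => Subtype.ext (hr y.1 fun g => y.2 g (AddSubgroup.mem_top g))⟩
  rwa [h1, mul_one, AddSubgroup.card_top] at key

/-- **`#K · #K^⊥ = #G`** for every subgroup `K ≤ G`, for a bi-additive pairing `e : G × H → ℤ/n` of finite abelian
groups non-degenerate on both sides (`K^⊥ ≤ H` the annihilator of `K`).  No hypothesis on the structure of `K`.
[cite: MumfordAV1970, §23 (p. 233)] [cite: SerreLinearRepresentations1977, §2.3] -/
theorem natCard_mul_natCard_annihilator [NeZero n] (e : G →+ H →+ ZMod n)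
    (hl : ∀ g : G, (∀ h : H, e g h = 0) → g = 0) (hr : ∀ h : H, (∀ g : G, e g h = 0) → h = 0)
    (K : AddSubgroup G) :
    Nat.card K * Nat.card {h : H // ∀ k ∈ K, e k h = 0} = Nat.card G := by
  rw [natCard_eq_of_nondegenerate e hl hr]
  exact natCard_mul_natCard_annihilator_of_forall e K fun k _ hk => hl k hk

/-- **`#L · #L^⊥ = #H`** for every subgroup `L ≤ H` and its annihilator `L^⊥ = {g : e(g, l) = 0 ∀ l ∈ L} ≤ G`, for a
bi-additive pairing `e : G × H → ℤ/n` of finite abelian groups non-degenerate on both sides (the previous statement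
for the flipped pairing). [cite: MumfordAV1970, §23 (p. 233)] -/
theorem natCard_mul_natCard_annihilator_left [NeZero n] (e : G →+ H →+ ZMod n)
    (hl : ∀ g : G, (∀ h : H, e g h = 0) → g = 0) (hr : ∀ h : H, (∀ g : G, e g h = 0) → h = 0)
    (L : AddSubgroup H) :
    Nat.card L * Nat.card {g : G // ∀ l ∈ L, e g l = 0} = Nat.card H := by
  have key := natCard_mul_natCard_annihilator e.flip (fun h hh => hr h fun g => by rw [← e.flip_apply]; exact hh g)
    (fun g hg => hl g fun h => by rw [← e.flip_apply]; exact hg h) L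
  simpa only [AddMonoidHom.flip_apply] using key

end Additive

end Literature.GroupTheory.Abelian.PerfectPairing

end
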